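import Summits.AtomisticToContinuum.HydrodynamicLimit.Theses.OneFlightGossipEngine
import Literature.MathematicalPhysics.KineticTheory.HardSphereEulerProofs

/-!
# Sketch — crux `KineticCurrentsLDAlongFamilies` (stmt-AtomisticToContinuum-16659), crux idea
# `static-threshold-net-transfer` (crux-ideate round 1, ideator 3)

First-lemma file of the idea card `idea-static-threshold-net-transfer.md`.

* `uniform_of_thresholdUniform_pointwise` — the ABSTRACT NET PRINCIPLE, PROVED: on a compact parameter set,
  a pointwise statement `∀ s, ∀ |β| ≤ β₁, ∀ ε ∃ τ₀ ∀ τ ≥ τ₀ ∃ N₀ ∀ N ≥ N₀, Λ s β τ N ≤ ε` with a threshold `β₁`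
  COMMON to all `s`, plus an equicontinuity-type comparison `Λ s β ≤ Λ s' (4β)/4 + δ` for `dist s s' < ρ(β,δ)`
  (eventually in `N`, for every `τ`), gives the FAMILY-UNIFORM statement (`∀ s` innermost) for `|β| ≤ β₁/4`.
  Only `β₀` precedes `ε` in the crux, so `ε`-dependent finite nets are legal for `τ₀, N₀` and for nothing else.
* `KCWFThresholdUniform` — the transfer target `C⁺`: the crux with `∀ s ∈ [0,t₁]` moved from the innermost
  position to just after `∃ β₀` (threshold uniform along the family; `τ₀, N₀` may depend on `s`).
* `KCWUSharp` — the family-free structural form: the pointwise rung 14662 with `∃ β₀` moved in front of the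
  profile, depending only on the class constant and on two-sided bounds of `θ₀` and a bound of `u₀`
  (and on `σ`, the flow family); `sharpToThresholdUniform_holds : KCWUSharp → KCWFThresholdUniform` is
  PROVED (compactness of `[0,t₁] × 𝕋³`), and `thresholdUniform_of_crux : crux → KCWFThresholdUniform` is
  PROVED (the transfer target is necessary).
* `RenyiQIAlongFamilies` — the shared Rényi quasi-invariance stub of the 14662 lines (`stub_windowRenyi`,
  isothermal case landed p96904, general case reduced to `stub_windowTransport` p123401), typed along families.
* `NetTransfer` — the line's concluding implication, as a `Prop` (to be the `_of` theorem of a crux-plan).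
-/

noncomputable section

open MeasureTheory Set Filter Topology
open scoped ENNReal BigOperators

namespace Summit.AtomisticToContinuum.HydrodynamicLimit.Cruxes.KineticCurrentsLDAlongFamilies.StaticThresholdNetTransfer

open Literature.Analysis.FluidPDE (HardSphereFlow Config localMaxwellian canonicalDensity liouville)
open Literature.MathematicalPhysics.KineticTheory (T3 V3 hsDiameter localGibbsLaw localGibbsProfile)
open Summit.AtomisticToContinuum.HydrodynamicLimit.Theses.OneFlightGossipEngine
  (KineticCurrentsLDAlongFamilies KineticCurrentsWindowLDUniform)

/-! ## 1. The abstract net principle (PROVED) -/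

/-- **Net principle.** `K` compact; `Λ s β τ N` any real functional (here: `(N+1)⁻¹ log` of the window
exponential moment at family parameter `s`). If (comparison) for every `β` and `δ > 0` there is `ρ > 0` such
that for every `τ > 0`, eventually in `N`, `Λ s β τ N ≤ Λ s' (4β) τ N / 4 + δ` whenever `s, s' ∈ K`,
`dist s s' < ρ`; and (pointwise, COMMON threshold `β₁`) for every `s ∈ K`, `|β| ≤ β₁`, `ε > 0` there is
`τ₀ > 0` with `∀ τ ≥ τ₀ ∃ N₀ ∀ N ≥ N₀, Λ s β τ N ≤ ε` — then the bound holds UNIFORMLY in `s ∈ K` for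
`|β| ≤ β₁/4`: `∀ ε ∃ τ₀ ∀ τ ≥ τ₀ ∃ N₀ ∀ N ≥ N₀ ∀ s ∈ K`. [folklore] -/
theorem uniform_of_thresholdUniform_pointwise {X : Type*} [PseudoMetricSpace X] {K : Set X}
    (hK : IsCompact K) (Λ : X → ℝ → ℝ → ℕ → ℝ) (β₁ : ℝ)
    (hcomp : ∀ β : ℝ, ∀ δ : ℝ, 0 < δ → ∃ ρ : ℝ, 0 < ρ ∧ ∀ τ : ℝ, 0 < τ → ∃ N₁ : ℕ, ∀ N : ℕ, N₁ ≤ N →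
      ∀ s ∈ K, ∀ s' ∈ K, dist s s' < ρ → Λ s β τ N ≤ Λ s' (4 * β) τ N / 4 + δ)
    (hpt : ∀ s ∈ K, ∀ β : ℝ, |β| ≤ β₁ → ∀ ε : ℝ, 0 < ε → ∃ τ₀ : ℝ, 0 < τ₀ ∧ ∀ τ : ℝ, τ₀ ≤ τ →
      ∃ N₀ : ℕ, ∀ N : ℕ, N₀ ≤ N → Λ s β τ N ≤ ε) :
    ∀ β : ℝ, |β| ≤ β₁ / 4 → ∀ ε : ℝ, 0 < ε → ∃ τ₀ : ℝ, 0 < τ₀ ∧ ∀ τ : ℝ, τ₀ ≤ τ →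
      ∃ N₀ : ℕ, ∀ N : ℕ, N₀ ≤ N → ∀ s ∈ K, Λ s β τ N ≤ ε := by
  intro β hβ ε hε
  obtain ⟨ρ, hρ, hcmp⟩ := hcomp β (ε / 2) (by linarith)
  -- a finite `ρ`-net of `K`
  obtain ⟨t, htK, hcover⟩ :=
    hK.elim_nhds_subcover (fun s => Metric.ball s ρ) (fun s _ => Metric.ball_mem_nhds s hρ)
  have h4β : |4 * β| ≤ β₁ := by
    rw [abs_mul, abs_of_pos (by norm_num : (0 : ℝ) < 4)]
    linarith
  -- the pointwise statement at the net points, at tilt `4β` and accuracy `2ε`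
  have hnet : ∀ s ∈ t, ∃ τ₀ : ℝ, 0 < τ₀ ∧ ∀ τ : ℝ, τ₀ ≤ τ →
      ∃ N₀ : ℕ, ∀ N : ℕ, N₀ ≤ N → Λ s (4 * β) τ N ≤ 2 * ε :=
    fun s hs => hpt s (htK s hs) (4 * β) h4β (2 * ε) (by linarith)
  choose! τf hτf using hnet
  have hτf_pos : ∀ s ∈ t, 0 < τf s := fun s hs => (hτf s hs).1
  have hsum_nonneg : 0 ≤ ∑ s ∈ t, τf s := Finset.sum_nonneg fun s hs => (hτf_pos s hs).le
  refine ⟨1 + ∑ s ∈ t, τf s, by linarith, ?_⟩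
  intro τ hτ
  have hτpos : 0 < τ := by linarith
  obtain ⟨N₁, hN₁⟩ := hcmp τ hτpos
  have hτk : ∀ s ∈ t, τf s ≤ τ := by
    intro s hs
    have h := Finset.single_le_sum (f := τf) (fun s' hs' => (hτf_pos s' hs').le) hs
    linarith
  have hN : ∀ s ∈ t, ∃ N₀ : ℕ, ∀ N : ℕ, N₀ ≤ N → Λ s (4 * β) τ N ≤ 2 * ε :=
    fun s hs => (hτf s hs).2 τ (hτk s hs)
  choose! Nf hNf using hN
  refine ⟨N₁ + ∑ s ∈ t, Nf s, ?_⟩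
  intro N hNle s hs
  have hsU := hcover hs
  rw [Set.mem_iUnion₂] at hsU
  obtain ⟨s', hs't, hss'⟩ := hsU
  have hdist : dist s s' < ρ := Metric.mem_ball.mp hss'
  have hN₁le : N₁ ≤ N := le_trans (Nat.le_add_right _ _) hNle
  have hNfle : Nf s' ≤ N := by
    have h1 : Nf s' ≤ ∑ x ∈ t, Nf x := Finset.single_le_sum (f := Nf) (fun _ _ => Nat.zero_le _) hs't
    omega
  have h1 := hN₁ N hN₁le s hs s' (htK s' hs't) hdist
  have h2 := hNf s' hs't N hNfle
  linarith

/-! ## 2. The window exponential functional of the crux (notation) -/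

/-- The window exponential moment of the crux at one local Gibbs law: `∫ exp(β ∑ᵢ w⁻¹∫₀ʷ F((Φ_r z)ᵢ) dr) dλ^N`,
`w = τ(N+1)^{-1/3}`, `λ^N = localGibbsLaw σ a u₀ θ₀ N Φ` (verbatim the crux's integrand). [folklore] -/
def windowMGF (σ : ℝ) (a θ₀ : T3 → ℝ) (u₀ : T3 → V3) (N : ℕ)
    (Φ : HardSphereFlow (Literature.Analysis.FluidPDE.Torus.geometry (Fin 3)) (hsDiameter σ N) (N + 1))
    (F : T3 × V3 → ℝ) (β τ : ℝ) : ℝ≥0∞ :=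
  ∫⁻ z, ENNReal.ofReal (Real.exp (β * ∑ i : Fin (N + 1),
      (τ * ((N : ℝ) + 1) ^ (-(1 / 3 : ℝ)))⁻¹ *
        ∫ r in (0 : ℝ)..(τ * ((N : ℝ) + 1) ^ (-(1 / 3 : ℝ))), F ((Φ.flow r z) i)))
    ∂(localGibbsLaw σ a u₀ θ₀ N Φ)

/-- The crux's restricted class member built from weights `(A, b, G)` centred at `u`:
`F(x,v) = Σ A_jk(x) w_j w_k + (b(x)·w) G(x,‖w‖²)`, `w = v − u(x)`. [folklore] -/
def classMember (u : T3 → V3) (A : T3 → Fin 3 → Fin 3 → ℝ) (b : T3 → V3) (G : T3 × ℝ → ℝ)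
    (y : T3 × V3) : ℝ :=
  (∑ j : Fin 3, ∑ k : Fin 3, A y.1 j k * ((y.2 - u y.1) j * (y.2 - u y.1) k)) +
    (∑ j : Fin 3, b y.1 j * (y.2 - u y.1) j) * G (y.1, ‖y.2 - u y.1‖ ^ 2)

/-! ## 3. The transfer target `C⁺` = threshold uniform along the family, everything dynamical pointwise -/

/-- **`C⁺` (KCWF with a family-uniform threshold only).** Verbatim the crux `KineticCurrentsLDAlongFamilies`
except that `∀ s ∈ [0,t₁]` stands right after `∃ β₀` instead of innermost: the tilt threshold is common to
the family, while the window threshold `τ₀` and the size threshold `N₀` may depend on `s`. Strictly between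
the pointwise rung `KineticCurrentsWindowLDUniform` (14662) and the crux; equivalent to the crux given the
comparison lemma and `RenyiQIAlongFamilies` (card). [folklore] -/
def KCWFThresholdUniform : Prop :=
  ∃ η₀ : ℝ, 0 < η₀ ∧ ∀ (t₁ : ℝ) (a θ₀ : ℝ → T3 → ℝ) (u₀ : ℝ → T3 → V3),
    Continuous (Function.uncurry a) → Continuous (Function.uncurry θ₀) → Continuous (Function.uncurry u₀) →
    (∀ s x, 0 < a s x) → (∀ s x, 0 < θ₀ s x) →
    ∀ σ : ℝ, 0 < σ → (∀ s ∈ Set.Icc 0 t₁, σ ^ 3 * (⨆ x, a s x) ≤ η₀ * ∫ x, a s x) →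
    ∀ Φ : (N : ℕ) → HardSphereFlow (Literature.Analysis.FluidPDE.Torus.geometry (Fin 3)) (hsDiameter σ N) (N + 1),
    ∀ (A : ℝ → T3 → Fin 3 → Fin 3 → ℝ) (b : ℝ → T3 → V3) (G : ℝ → T3 × ℝ → ℝ),
    Continuous (Function.uncurry A) → Continuous (Function.uncurry b) → Continuous (Function.uncurry G) →
    (∃ C : ℝ, ∀ s ∈ Set.Icc 0 t₁, ∀ y : T3 × V3,
        |classMember (u₀ s) (A s) (b s) (G s) y| ≤ C * (1 + ‖y.2‖ ^ 2)) →
    (∀ s ∈ Set.Icc 0 t₁, ∀ x, ∫ v, classMember (u₀ s) (A s) (b s) (G s) (x, v) *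
        localMaxwellian 1 (θ₀ s x) (u₀ s x) v = 0) →
    (∀ s ∈ Set.Icc 0 t₁, ∀ x (j : Fin 3), ∫ v, classMember (u₀ s) (A s) (b s) (G s) (x, v) * v j *
        localMaxwellian 1 (θ₀ s x) (u₀ s x) v = 0) →
    (∀ s ∈ Set.Icc 0 t₁, ∀ x, ∫ v, classMember (u₀ s) (A s) (b s) (G s) (x, v) * ‖v‖ ^ 2 *
        localMaxwellian 1 (θ₀ s x) (u₀ s x) v = 0) →
    ∃ β₀ : ℝ, 0 < β₀ ∧ ∀ s ∈ Set.Icc 0 t₁, ∀ β : ℝ, |β| ≤ β₀ → ∀ ε : ℝ, 0 < ε →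
      ∃ τ₀ : ℝ, 0 < τ₀ ∧ ∀ τ : ℝ, τ₀ ≤ τ → ∃ N₀ : ℕ, ∀ N : ℕ, N₀ ≤ N →
        windowMGF σ (a s) (θ₀ s) (u₀ s) N (Φ N) (classMember (u₀ s) (A s) (b s) (G s)) β τ ≤
          ENNReal.ofReal (Real.exp (ε * ((N : ℝ) + 1)))

/-- `C⁺` is implied by the crux (quantifier permutation: the crux's `β₀` already serves every `s`), so the
transfer target is NECESSARY — the transfer loses nothing. [folklore] -/
theorem thresholdUniform_of_crux : KineticCurrentsLDAlongFamilies → KCWFThresholdUniform := by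
  rintro ⟨η₀, hη₀, H⟩
  refine ⟨η₀, hη₀, ?_⟩
  intro t₁ a θ₀ u₀ ha hθ hu hapos hθpos σ hσ hguard Φ A b G hA hb hG hC h1 h2 h3
  obtain ⟨β₀, hβ₀, H2⟩ := H t₁ a θ₀ u₀ ha hθ hu hapos hθpos σ hσ hguard Φ A b G hA hb hG hC h1 h2 h3
  refine ⟨β₀, hβ₀, fun s hs β hβ ε hε => ?_⟩
  obtain ⟨τ₀, hτ₀, H3⟩ := H2 β hβ ε hε
  refine ⟨τ₀, hτ₀, fun τ hτ => ?_⟩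
  obtain ⟨N₀, H4⟩ := H3 τ hτ
  exact ⟨N₀, fun N hN => H4 N hN s hs⟩

/-! ## 4. The family-free structural form -/

/-- **`KCWUSharp` (structural threshold).** The pointwise docking rung with `∃ β₀` moved in front of the
profile: `β₀` depends only on `σ`, the flow family, the class constant `C` and a common two-sided bound `Θ`
(`Θ⁻¹ ≤ θ₀ ≤ Θ`, `‖u₀‖ ≤ Θ`); window and size thresholds stay pointwise. Every 14662 line produces its `β₀`
statically in exactly this form (integrability / Csiszár LE-gain threshold). Implies `KCWFThresholdUniform`
by compactness of `[0,t₁] × 𝕋³`; NOT implied by 14662 (Skolem thresholds with infimum `0`). [folklore] -/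
def KCWUSharp : Prop :=
  ∃ η₀ : ℝ, 0 < η₀ ∧ ∀ σ : ℝ, 0 < σ →
    ∀ Φ : (N : ℕ) → HardSphereFlow (Literature.Analysis.FluidPDE.Torus.geometry (Fin 3)) (hsDiameter σ N) (N + 1),
    ∀ (C Θ : ℝ), 0 < Θ → ∃ β₀ : ℝ, 0 < β₀ ∧
    ∀ (a θ₀ : T3 → ℝ) (u₀ : T3 → V3), Continuous a → Continuous θ₀ → Continuous u₀ →
    (∀ x, 0 < a x) → (∀ x, Θ⁻¹ ≤ θ₀ x ∧ θ₀ x ≤ Θ) → (∀ x, ‖u₀ x‖ ≤ Θ) →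
    σ ^ 3 * (⨆ x, a x) ≤ η₀ * ∫ x, a x →
    ∀ (A : T3 → Fin 3 → Fin 3 → ℝ) (b : T3 → V3) (G : T3 × ℝ → ℝ),
    Continuous A → Continuous b → Continuous G →
    (∀ y : T3 × V3, |classMember u₀ A b G y| ≤ C * (1 + ‖y.2‖ ^ 2)) →
    (∀ x, ∫ v, classMember u₀ A b G (x, v) * localMaxwellian 1 (θ₀ x) (u₀ x) v = 0) →
    (∀ x (j : Fin 3), ∫ v, classMember u₀ A b G (x, v) * v j * localMaxwellian 1 (θ₀ x) (u₀ x) v = 0) →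
    ∀ β : ℝ, |β| ≤ β₀ → ∀ ε : ℝ, 0 < ε → ∃ τ₀ : ℝ, 0 < τ₀ ∧ ∀ τ : ℝ, τ₀ ≤ τ →
      ∃ N₀ : ℕ, ∀ N : ℕ, N₀ ≤ N →
        windowMGF σ a θ₀ u₀ N (Φ N) (classMember u₀ A b G) β τ ≤ ENNReal.ofReal (Real.exp (ε * ((N : ℝ) + 1)))

/-! ## 5. The shared quasi-invariance stub, along families -/

/-- **Rényi quasi-invariance of local Gibbs over a kinetic window, along families.** Family version of the
registered shared stub `stub_windowRenyi` of the 14662 lines (isothermal case landed, p96904; general case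
reduced to kinetic-window transport tightness `stub_windowTransport`, p123401): for a jointly continuous
family of positive profiles there is a Rényi order `p > 1` such that for every window parameter `τ`, every
`δ > 0` and every flow family, for all large `N`, uniformly in `s ∈ [0,t₁]` and `r ∈ [0, τ(N+1)^{-1/3}]`,
`∫ ψ_s(Φ_{-r} z)^p ψ_s(z)^{1-p} dL ≤ e^{pδ(N+1)}`, `ψ_s` the canonical local Gibbs density at parameter `s`.
Necessarily `p < R/(R-1)`, `R = sup θ / inf θ` over the family (twin Disproof §7). [folklore] -/
def RenyiQIAlongFamilies : Prop :=
  ∀ (t₁ : ℝ) (a θ₀ : ℝ → T3 → ℝ) (u₀ : ℝ → T3 → V3),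
    Continuous (Function.uncurry a) → Continuous (Function.uncurry θ₀) → Continuous (Function.uncurry u₀) →
    (∀ s x, 0 < a s x) → (∀ s x, 0 < θ₀ s x) → ∀ σ : ℝ, 0 < σ → σ ≤ 1 / 2 →
    ∃ p : ℝ, 1 < p ∧ ∀ τ : ℝ, 0 < τ → ∀ δ : ℝ, 0 < δ →
    ∀ Φ : (N : ℕ) → HardSphereFlow (Literature.Analysis.FluidPDE.Torus.geometry (Fin 3)) (hsDiameter σ N) (N + 1),
    ∃ N₀ : ℕ, ∀ N : ℕ, N₀ ≤ N → ∀ s ∈ Set.Icc 0 t₁, ∀ r ∈ Set.Icc (0 : ℝ) (τ * ((N : ℝ) + 1) ^ (-(1 / 3 : ℝ))),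
      ∫⁻ z, ENNReal.ofReal (canonicalDensity (Literature.Analysis.FluidPDE.Torus.geometry (Fin 3))
            (hsDiameter σ N) (N + 1) (localGibbsProfile (a s) (u₀ s) (θ₀ s)) ((Φ N).flow (-r) z)) ^ p *
          ENNReal.ofReal (canonicalDensity (Literature.Analysis.FluidPDE.Torus.geometry (Fin 3))
            (hsDiameter σ N) (N + 1) (localGibbsProfile (a s) (u₀ s) (θ₀ s)) z) ^ (1 - p)
        ∂(liouville (Literature.Analysis.FluidPDE.Torus.geometry (Fin 3)) (N + 1) (hsDiameter σ N)) ≤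
      ENNReal.ofReal (Real.exp (p * (δ * ((N : ℝ) + 1))))

/-! ## 6. The line's concluding implications (statements; the `_of` theorems of a crux-plan) -/

/-- The transfer: threshold-uniform pointwise KCWF + quasi-invariance along families ⇒ the crux BY NAME.
Proof plan (card): Hölder measure swap `λ_s → λ_{s_k}` (Gaussian mgf of the log-likelihood ratio, cost
`c(δ)(N+1)`), sup-norm functional swap on `{‖v‖ ≤ V}` by joint uniform continuity of `(s,x,v) ↦ F_s(x,v)`,
quadratic tails static by Jensen-in-time + `RenyiQIAlongFamilies`, then
`uniform_of_thresholdUniform_pointwise` on `K = [0,t₁]`. [folklore] -/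
def NetTransfer : Prop :=
  KCWFThresholdUniform → RenyiQIAlongFamilies → KineticCurrentsLDAlongFamilies

/-- The structural form feeds the transfer target (compactness of `[0,t₁] × 𝕋³` gives `C, Θ`). [folklore] -/
def SharpToThresholdUniform : Prop :=
  KCWUSharp → KCWFThresholdUniform

/-- `KCWUSharp → KCWFThresholdUniform`, PROVED: the two-sided temperature bound and the drift bound along the
family come from compactness of `[0,t₁] × 𝕋³`; the energy row is not needed. [folklore] -/
theorem sharpToThresholdUniform_holds : SharpToThresholdUniform := by
  rintro ⟨η₀, hη₀, H⟩
  refine ⟨η₀, hη₀, ?_⟩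
  intro t₁ a θ₀ u₀ ha hθ hu hapos hθpos σ hσ hguard Φ A b G hA hb hG hC h1 h2 _h3
  obtain ⟨C, hC⟩ := hC
  by_cases ht : 0 ≤ t₁
  swap
  · refine ⟨1, one_pos, fun s hs => ?_⟩
    exact absurd (hs.1.trans hs.2) (not_le.mpr (lt_of_not_ge ht))
  · set K : Set (ℝ × T3) := Set.Icc (0 : ℝ) t₁ ×ˢ (Set.univ : Set T3) with hKdef
    have hK : IsCompact K := isCompact_Icc.prod isCompact_univ
    have hKne : K.Nonempty := ⟨((0 : ℝ), (0 : T3)), Set.mk_mem_prod ⟨le_rfl, ht⟩ (Set.mem_univ _)⟩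
    obtain ⟨pm, _hpmK, hpm⟩ := hK.exists_isMinOn hKne hθ.continuousOn
    obtain ⟨pM, _hpMK, hpM⟩ := hK.exists_isMaxOn hKne hθ.continuousOn
    obtain ⟨pU, _hpUK, hpU⟩ := hK.exists_isMaxOn hKne (continuous_norm.comp hu).continuousOn
    have hθm_pos : 0 < Function.uncurry θ₀ pm := hθpos pm.1 pm.2
    set Θ : ℝ := max (max (Function.uncurry θ₀ pM) (Function.uncurry θ₀ pm)⁻¹)
      (max ‖Function.uncurry u₀ pU‖ 1) with hΘdef
    have hΘpos : 0 < Θ := lt_of_lt_of_le one_pos ((le_max_right _ _).trans (le_max_right _ _))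
    have hΘinv : Θ⁻¹ ≤ Function.uncurry θ₀ pm := by
      have h1 : (Function.uncurry θ₀ pm)⁻¹ ≤ Θ := (le_max_right _ _).trans (le_max_left _ _)
      calc Θ⁻¹ ≤ ((Function.uncurry θ₀ pm)⁻¹)⁻¹ := by
            exact inv_anti₀ (inv_pos.mpr hθm_pos) h1
        _ = Function.uncurry θ₀ pm := inv_inv _
    obtain ⟨β₀, hβ₀, H2⟩ := H σ hσ Φ C Θ hΘpos
    refine ⟨β₀, hβ₀, fun s hs β hβ ε hε => ?_⟩
    have hmem : ∀ x : T3, (s, x) ∈ K := fun x => Set.mk_mem_prod hs (Set.mem_univ x)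
    have hθb : ∀ x, Θ⁻¹ ≤ θ₀ s x ∧ θ₀ s x ≤ Θ := by
      intro x
      refine ⟨hΘinv.trans (hpm (hmem x)), ?_⟩
      exact (show Function.uncurry θ₀ (s, x) ≤ Function.uncurry θ₀ pM from hpM (hmem x)).trans
        ((le_max_left _ _).trans (le_max_left _ _))
    have hub : ∀ x, ‖u₀ s x‖ ≤ Θ := by
      intro x
      exact (show ‖Function.uncurry u₀ (s, x)‖ ≤ ‖Function.uncurry u₀ pU‖ from hpU (hmem x)).trans
        ((le_max_left _ _).trans (le_max_right _ _))
    exact H2 (a s) (θ₀ s) (u₀ s) (ha.uncurry_left s) (hθ.uncurry_left s) (hu.uncurry_left s)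
      (hapos s) hθb hub (hguard s hs) (A s) (b s) (G s) (hA.uncurry_left s) (hb.uncurry_left s)
      (hG.uncurry_left s) (hC s hs) (h1 s hs) (h2 s hs) β hβ ε hε

end Summit.AtomisticToContinuum.HydrodynamicLimit.Cruxes.KineticCurrentsLDAlongFamilies.StaticThresholdNetTransfer
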